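import Summits.AtomisticToContinuum.HydrodynamicLimit.Theorems.AntiMazurCoboundariesKineticFluxLdDecayHTheoremObjectsE
import Summits.AtomisticToContinuum.HydrodynamicLimit.Theorems.AntiMazurCoboundariesKineticFluxLdDecayWindowDuality
import Summits.AtomisticToContinuum.HydrodynamicLimit.Theorems.AntiMazurCoboundariesKineticFluxLdDecayOneBodyMarginal
import Summits.AtomisticToContinuum.HydrodynamicLimit.Theorems.OneFlightGossipEngineKineticCurrentsWindowLDUniformLedgerAssemblyDuality
import Summits.AtomisticToContinuum.HydrodynamicLimit.Theorems.JParityClosureEvenStressEnskogVelocityFactorisation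
import HarnessLib

/-!
# The crux makes its own optimal enemy entropically negligible (`stub_tiltEntropyVanishing_of_crux`,
# line `h-theorem-dissipation-budget`, crux `KineticFluxLdDecay`, stmt-AtomisticToContinuum-10967)

Registered stub of the skeleton of reshape 4 (objects part E,
`Theorems/AntiMazurCoboundariesKineticFluxLdDecayHTheoremObjectsE.lean`):
`KineticFluxLdDecay → TiltEntropyVanishing`, i.e. the crux at amplitude `κ` implies that for admissible
`φ, g` with `|g| ≤ κ/2` and every `ε > 0` the crux's own optimal enemy, the tilted law
`G_N^X = e^X G_N / E_{G_N} e^X` of the window average `X = h⁻¹ ∫₀ʰ F∘Φ_t dt` of the flux observable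
`F = Σᵢ φ(xᵢ) g(wᵢ)`, has `KL(G_N^X ‖ G_N) ≤ ε (N+1)` at the crux's window for all large `N` and every flow.

Proof (finite `N`, three lines of convex duality):
* the crux applied to the admissible observable `2g` (amplitude `κ`) bounds the SECOND exponential moment
  `E_{G_N} e^{2X} ≤ e^{ε(N+1)}` (the flux observable and the window average are linear in `g`:
  `windowAvg_fluxObs_two_mul`);
* Donsker–Varadhan at `2X` against the tilted law (`LedgerAssembly.integral_le_klDiv_add_log`):
  `2 E_{G^X} X ≤ KL(G^X ‖ G) + log E_G e^{2X}`, and the Gibbs variational identity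
  (`LedgerAssembly.klDiv_tilted_eq`): `KL(G^X ‖ G) = E_{G^X} X − log E_G e^X`;
* CENTRING: `E_G X = 0` — Fubini for the window average (`windowAvg_fubini`), flow-invariance of `G_N`
  (`integral_comp_flow_localGibbsLaw_const`), independence of positions and velocities under `G_N` with
  i.i.d. `N(u₀, θ)` velocities (`EvenStressEnskog.integral_pos_mul_vel_localGibbsLaw_const`,
  `map_gaussMeasure_reduce`) and `∫ g dγ = 0` (orthogonality to the constants) — so `log E_G e^X ≥ 0` by
  `e^x ≥ 1 + x`, whence `KL ≤ E_{G^X} X` and `2 KL ≤ 2 E_{G^X} X ≤ KL + ε(N+1)`.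

The generic step is `klDiv_tilted_le_of_centred`: for a probability law `μ` and a bounded, centred,
a.e.-measurable `X` with `∫⁻ e^{2X} dμ ≤ e^B`, `KL(μ^X ‖ μ) ≤ B`.

Reference: C. Kipnis, C. Landim, *Scaling Limits of Interacting Particle Systems* (1999), App. 1 §8
(entropy inequality and the variational formula).
-/

noncomputable section

open MeasureTheory ProbabilityTheory Set Filter InformationTheory
open scoped ENNReal

namespace Summit.AtomisticToContinuum.HydrodynamicLimit.Theorems.HTheorem

open Literature.MathematicalPhysics.KineticTheory (T3 V3 hsDiameter localGibbsLaw gaussMeasure)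
open Literature.Analysis.FluidPDE (HardSphereFlow Config)
open Summit.AtomisticToContinuum.HydrodynamicLimit.Theorems.KineticCurrentsWindowLDUniformGossip
  (LedgerAssembly.klDiv_tilted_eq LedgerAssembly.integral_le_klDiv_add_log
    LedgerAssembly.integrable_exp_of_lintegral_le)

namespace TiltEntropyOfCrux

/-! ### Generic step: a centred bounded tilt with a second exponential moment has small entropy -/

/-- **Entropy of a centred tilt from its second exponential moment.** For a probability law `μ` and a
bounded `μ`-a.e. measurable `X` with `∫ X dμ = 0` and `∫⁻ e^{2X} dμ ≤ e^B`:
`KL(μ.tilted X ‖ μ) ≤ B`. (Gibbs variational identity `KL = ∫ X dμ^X − log ∫ e^X dμ`, centring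
`log ∫ e^X dμ ≥ log ∫ (1 + X) dμ = 0`, and Donsker–Varadhan `2 ∫ X dμ^X ≤ KL + log ∫ e^{2X} dμ`.) -/
theorem klDiv_tilted_le_of_centred {α : Type*} [MeasurableSpace α] {μ : Measure α}
    [IsProbabilityMeasure μ] {X : α → ℝ} (hXm : AEMeasurable X μ) {C : ℝ} (hXb : ∀ x, |X x| ≤ C)
    (hX0 : ∫ x, X x ∂μ = 0) {B : ℝ}
    (h2 : ∫⁻ x, ENNReal.ofReal (Real.exp (2 * X x)) ∂μ ≤ ENNReal.ofReal (Real.exp B)) :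
    klDiv (μ.tilted X) μ ≤ ENNReal.ofReal B := by
  have hXμ : Integrable X μ := integrable_of_aemeasurable_of_abs_le hXm hXb
  have hexpX : Integrable (fun x => Real.exp (X x)) μ :=
    integrable_of_aemeasurable_of_abs_le (Real.measurable_exp.comp_aemeasurable hXm) fun x => by
      rw [Real.abs_exp]
      exact Real.exp_le_exp.2 ((le_abs_self _).trans (hXb x))
  haveI hνP : IsProbabilityMeasure (μ.tilted X) := isProbabilityMeasure_tilted hexpX
  have hac : μ.tilted X ≪ μ := tilted_absolutelyContinuous μ X
  have hXν : Integrable X (μ.tilted X) := integrable_of_aemeasurable_of_abs_le (hXm.mono_ac hac) hXb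
  -- Gibbs variational identity
  obtain ⟨hkl, hklr⟩ := LedgerAssembly.klDiv_tilted_eq hexpX hXν
  -- the second exponential moment, as a Bochner integral
  have h2m : AEStronglyMeasurable (fun x => 2 * X x) μ := (hXm.const_mul 2).aestronglyMeasurable
  obtain ⟨hexp2, hint2⟩ := LedgerAssembly.integrable_exp_of_lintegral_le h2m h2
  have hlog2 : Real.log (∫ x, Real.exp (2 * X x) ∂μ) ≤ B := by
    rw [← Real.log_exp B]
    exact Real.log_le_log (integral_exp_pos hexp2) hint2
  -- Donsker–Varadhan at `2X`
  have hDV := LedgerAssembly.integral_le_klDiv_add_log hkl (hXν.const_mul 2) hexp2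
  rw [integral_const_mul] at hDV
  -- centring: `log ∫ e^X dμ ≥ 0`
  have hlog1 : 0 ≤ Real.log (∫ x, Real.exp (X x) ∂μ) := by
    refine Real.log_nonneg ?_
    have h1 : ∫ x, (X x + 1) ∂μ = 1 := by
      rw [integral_add hXμ (integrable_const _), hX0, integral_const, probReal_univ, one_smul, zero_add]
    calc (1 : ℝ) = ∫ x, (X x + 1) ∂μ := h1.symm
      _ ≤ ∫ x, Real.exp (X x) ∂μ :=
          integral_mono (hXμ.add (integrable_const _)) hexpX fun x => Real.add_one_le_exp (X x)
  have hfin : (klDiv (μ.tilted X) μ).toReal ≤ B := by linarith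
  rw [← ENNReal.ofReal_toReal hkl]
  exact ENNReal.ofReal_le_ofReal hfin

/-! ### Frame facts: linearity in `g` and centring of the flux observable under the Gibbs law -/

/-- The flux observable is linear in the one-body velocity test function: `F(φ, 2g) = 2 F(φ, g)`. -/
theorem fluxObs_two_mul (θ : ℝ) (u₀ : V3) (φ : T3 → ℝ) (g : V3 → ℝ) (N : ℕ) (z : Phase N) :
    fluxObs θ u₀ φ (fun w => 2 * g w) N z = 2 * fluxObs θ u₀ φ g N z := by
  simp only [fluxObs, Finset.mul_sum]
  exact Finset.sum_congr rfl fun i _ => by ring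

/-- The window average is linear in the observable: `X(φ, 2g) = 2 X(φ, g)` (pointwise, every window;
`intervalIntegral.integral_const_mul` needs no integrability). -/
theorem windowAvg_fluxObs_two_mul {σ : ℝ} (θ : ℝ) (u₀ : V3) (φ : T3 → ℝ) (g : V3 → ℝ) (N : ℕ)
    (Φ : Flow σ N) (h : ℝ) (z : Phase N) :
    windowAvg Φ (fluxObs θ u₀ φ (fun w => 2 * g w) N) h z =
      2 * windowAvg Φ (fluxObs θ u₀ φ g N) h z := by
  have hF : (fun r : ℝ => fluxObs θ u₀ φ (fun w => 2 * g w) N (Φ.flow r z)) =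
      fun r => 2 * fluxObs θ u₀ φ g N (Φ.flow r z) :=
    funext fun r => fluxObs_two_mul θ u₀ φ g N _
  show h⁻¹ * intervalIntegral (fun r : ℝ => fluxObs θ u₀ φ (fun w => 2 * g w) N (Φ.flow r z)) 0 h
      volume = 2 * (h⁻¹ * intervalIntegral (fun r : ℝ => fluxObs θ u₀ φ g N (Φ.flow r z)) 0 h volume)
  rw [hF, intervalIntegral.integral_const_mul]
  ring

/-- **`g ⊥ 1` in `L²(γ)`**: an orthogonal `g` has Gaussian mean zero (`(c₀, b, c₂) = (1, 0, 0)`). -/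
theorem integral_stdGaussian_eq_zero_of_orthogonal {g : V3 → ℝ} (horth : Orthogonal g) :
    ∫ w, g w ∂(stdGaussian V3) = 0 := by
  have h := horth 1 0 0
  simpa only [inner_zero_left, zero_mul, add_zero, mul_one] using h

/-- **The flux observable is centred under the global Gibbs law**: `E_{G_N} F = 0` for constant profiles
`a, θ > 0`, `σ ≤ 1/2`, continuous bounded `φ, g` with `g ⊥ 1` — positions and velocities are independent
under `G_N` with i.i.d. `N(u₀, θ)` velocities (`EvenStressEnskog.integral_pos_mul_vel_localGibbsLaw_const`),
the reduced velocity `(v − u₀)/√θ` is standard Gaussian (`map_gaussMeasure_reduce`), and `∫ g dγ = 0`. -/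
theorem integral_fluxObs_gibbs {σ a θ : ℝ} (ha : 0 < a) (hθ : 0 < θ) (hσ : σ ≤ 1 / 2) (u₀ : V3)
    {φ : T3 → ℝ} {g : V3 → ℝ} (hφ : Continuous φ) (hg : Continuous g) (hφ1 : ∀ x, |φ x| ≤ 1)
    {κ : ℝ} (hgκ : ∀ w, |g w| ≤ κ) (horth : Orthogonal g) (N : ℕ) (Φ : Flow σ N) :
    ∫ z, fluxObs θ u₀ φ g N z ∂(gibbs σ a θ u₀ N Φ) = 0 := by
  haveI := isProbabilityMeasure_gibbs ha hθ hσ u₀ N Φ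
  have hg0 : ∫ w, g w ∂(stdGaussian V3) = 0 := integral_stdGaussian_eq_zero_of_orthogonal horth
  have hred : Measurable fun v : V3 => (Real.sqrt θ)⁻¹ • (v - u₀) := by fun_prop
  -- one reduced Gaussian velocity
  have hg1 : ∫ v, g ((Real.sqrt θ)⁻¹ • (v - u₀)) ∂(gaussMeasure u₀ θ) = 0 := by
    rw [← integral_map hred.aemeasurable hg.aestronglyMeasurable, map_gaussMeasure_reduce hθ u₀, hg0]
  -- one coordinate of the product Gaussian
  have hg2 : ∀ i : Fin (N + 1), ∫ v : Fin (N + 1) → V3, g ((Real.sqrt θ)⁻¹ • (v i - u₀))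
      ∂(Measure.pi fun _ : Fin (N + 1) => gaussMeasure u₀ θ) = 0 := fun i => by
    rw [MeasureTheory.integral_comp_eval (μ := fun _ : Fin (N + 1) => gaussMeasure u₀ θ)
      (f := fun w : V3 => g ((Real.sqrt θ)⁻¹ • (w - u₀))) (hg.comp_aestronglyMeasurable ?_)]
    · exact hg1
    · exact hred.aestronglyMeasurable
  -- each summand factorises through the velocity marginal
  have hsum : ∀ i : Fin (N + 1),
      ∫ z, φ (z i).1 * g ((Real.sqrt θ)⁻¹ • ((z i).2 - u₀)) ∂(gibbs σ a θ u₀ N Φ) = 0 := fun i => by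
    have h : ∫ z, φ (z i).1 * g ((Real.sqrt θ)⁻¹ • ((z i).2 - u₀)) ∂(gibbs σ a θ u₀ N Φ) =
        (∫ x, φ (x i) ∂(Literature.MathematicalPhysics.KineticTheory.posGibbsMeasure (fun _ : T3 => a)
          (hsDiameter σ N) (N + 1))) *
          ∫ v : Fin (N + 1) → V3, g ((Real.sqrt θ)⁻¹ • (v i - u₀))
            ∂(Measure.pi fun _ : Fin (N + 1) => gaussMeasure u₀ θ) :=
      EvenStressEnskog.integral_pos_mul_vel_localGibbsLaw_const σ ha.le hθ u₀ N Φ (fun x => φ (x i))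
        fun v => g ((Real.sqrt θ)⁻¹ • (v i - u₀))
    rw [h, hg2 i, mul_zero]
  -- sum over particles
  have hκ0 : 0 ≤ κ := (abs_nonneg _).trans (hgκ 0)
  have hint : ∀ i : Fin (N + 1), Integrable
      (fun z : Phase N => φ (z i).1 * g ((Real.sqrt θ)⁻¹ • ((z i).2 - u₀))) (gibbs σ a θ u₀ N Φ) :=
    fun i => by
    have hc : Continuous fun z : Phase N => φ (z i).1 * g ((Real.sqrt θ)⁻¹ • ((z i).2 - u₀)) := by
      fun_prop
    refine Integrable.of_bound hc.aestronglyMeasurable κ (ae_of_all _ fun z => ?_)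
    rw [Real.norm_eq_abs, abs_mul]
    exact (mul_le_mul (hφ1 _) (hgκ _) (abs_nonneg _) zero_le_one).trans_eq (one_mul κ)
  calc ∫ z, fluxObs θ u₀ φ g N z ∂(gibbs σ a θ u₀ N Φ)
      = ∑ i, ∫ z, φ (z i).1 * g ((Real.sqrt θ)⁻¹ • ((z i).2 - u₀)) ∂(gibbs σ a θ u₀ N Φ) :=
        integral_finsetSum _ fun i _ => hint i
    _ = 0 := Finset.sum_eq_zero fun i _ => hsum i

/-- **The window average of the flux observable is centred under the global Gibbs law**:
`E_{G_N} X = h⁻¹ ∫₀ʰ E_{G_N} F∘Φ_t dt = h⁻¹ ∫₀ʰ E_{G_N} F dt = 0` (Fubini `windowAvg_fubini`, the Gibbs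
law is carried by the good set; flow-invariance `integral_comp_flow_localGibbsLaw_const`; centring
`integral_fluxObs_gibbs`). -/
theorem integral_windowAvg_fluxObs_gibbs {σ a θ : ℝ} (ha : 0 < a) (hθ : 0 < θ) (hσ : σ ≤ 1 / 2)
    (u₀ : V3) {φ : T3 → ℝ} {g : V3 → ℝ} (hφ : Continuous φ) (hg : Continuous g)
    (hφ1 : ∀ x, |φ x| ≤ 1) {κ : ℝ} (hgκ : ∀ w, |g w| ≤ κ) (horth : Orthogonal g) (N : ℕ)
    (Φ : Flow σ N) {h : ℝ} (hh : 0 < h) :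
    ∫ z, windowAvg Φ (fluxObs θ u₀ φ g N) h z ∂(gibbs σ a θ u₀ N Φ) = 0 := by
  haveI := isProbabilityMeasure_gibbs ha hθ hσ u₀ N Φ
  have hgood : gibbs σ a θ u₀ N Φ Φ.goodᶜ = 0 :=
    gibbs_absolutelyContinuous σ a θ u₀ N Φ Φ.measure_compl_good
  have hFm : Measurable (fluxObs θ u₀ φ g N) := measurable_fluxObs θ u₀ hφ.measurable hg.measurable N
  have hFb : ∀ z, |fluxObs θ u₀ φ g N z| ≤ ((N + 1 : ℕ) : ℝ) * κ := abs_fluxObs_le θ u₀ hφ1 hgκ N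
  obtain ⟨-, hfub⟩ := windowAvg_fubini Φ hgood hFm hFb hh
  have hinv : ∀ t : ℝ, ∫ z, fluxObs θ u₀ φ g N (Φ.flow t z) ∂(gibbs σ a θ u₀ N Φ) = 0 := fun t => by
    rw [integral_comp_flow_localGibbsLaw_const σ a θ u₀ N Φ t hFm.aestronglyMeasurable]
    exact integral_fluxObs_gibbs ha hθ hσ u₀ hφ hg hφ1 hgκ horth N Φ
  rw [hfub]
  simp only [hinv, intervalIntegral.integral_zero, mul_zero]

/-- **Entropy of the optimal enemy from the second exponential moment** (crux frame): for constant profiles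
`a, θ > 0`, `σ ≤ 1/2`, admissible `φ, g` (`g ⊥ span{1, v, |v|²}`) and a window `τ > 0`, if
`E_{G_N} e^{2X} ≤ e^B` for the window average `X` of the flux observable then `KL(G_N^X ‖ G_N) ≤ B`. -/
theorem klDiv_tiltedGibbs_le_of_exp_two {σ a θ : ℝ} (ha : 0 < a) (hθ : 0 < θ) (hσ : σ ≤ 1 / 2)
    (u₀ : V3) {φ : T3 → ℝ} {g : V3 → ℝ} (hφ : Continuous φ) (hg : Continuous g)
    (hφ1 : ∀ x, |φ x| ≤ 1) {κ : ℝ} (hgκ : ∀ w, |g w| ≤ κ) (horth : Orthogonal g) {τ : ℝ} (hτ : 0 < τ)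
    (N : ℕ) (Φ : Flow σ N) {B : ℝ}
    (h2 : ∫⁻ z, ENNReal.ofReal (Real.exp (2 * windowAvg Φ (fluxObs θ u₀ φ g N) (window τ N) z))
        ∂(gibbs σ a θ u₀ N Φ) ≤ ENNReal.ofReal (Real.exp B)) :
    klDiv (tiltedGibbs σ a θ u₀ φ g τ N Φ) (gibbs σ a θ u₀ N Φ) ≤ ENNReal.ofReal B := by
  haveI := isProbabilityMeasure_gibbs ha hθ hσ u₀ N Φ
  have hgood : gibbs σ a θ u₀ N Φ Φ.goodᶜ = 0 :=
    gibbs_absolutelyContinuous σ a θ u₀ N Φ Φ.measure_compl_good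
  have hFm : Measurable (fluxObs θ u₀ φ g N) := measurable_fluxObs θ u₀ hφ.measurable hg.measurable N
  have hFb : ∀ z, |fluxObs θ u₀ φ g N z| ≤ ((N + 1 : ℕ) : ℝ) * κ := abs_fluxObs_le θ u₀ hφ1 hgκ N
  have hh : 0 < window τ N := mul_pos hτ (Real.rpow_pos_of_pos (by positivity) _)
  exact klDiv_tilted_le_of_centred (aemeasurable_windowAvg Φ hgood hFm (window τ N))
    (fun z => abs_windowAvg_le Φ hFb hh z)
    (integral_windowAvg_fluxObs_gibbs ha hθ hσ u₀ hφ hg hφ1 hgκ horth N Φ hh) h2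

end TiltEntropyOfCrux

open TiltEntropyOfCrux

/-- **The crux implies that its optimal enemy is entropically negligible** (registered stub
`stub_tiltEntropyVanishing_of_crux` of line `h-theorem-dissipation-budget`, skeleton of reshape 4):
`KineticFluxLdDecay → TiltEntropyVanishing`, at half the crux's amplitude and below reduced density
`min σ₀ ½` — the crux applied to `2g` bounds `E_G e^{2X}`, and `klDiv_tiltedGibbs_le_of_exp_two`. -/
theorem stub_tiltEntropyVanishing_of_crux :
    Summit.AtomisticToContinuum.HydrodynamicLimit.Theses.AntiMazurCoboundaries.KineticFluxLdDecay →
      TiltEntropyVanishing := by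
  intro hcrux a θ u₀ ha hθ
  obtain ⟨σ₀, hσ₀, H⟩ := hcrux a θ u₀ ha hθ
  refine ⟨min σ₀ (1 / 2), lt_min hσ₀ (by norm_num), fun σ hσ hσlt => ?_⟩
  have hσ1 : σ < σ₀ := hσlt.trans_le (min_le_left _ _)
  have hσ2 : σ ≤ 1 / 2 := (hσlt.trans_le (min_le_right _ _)).le
  obtain ⟨-, κ, hκ, H'⟩ := H σ hσ hσ1
  refine ⟨κ / 2, half_pos hκ, fun φ g hφ hg hφ1 hgκ horth ε hε => ?_⟩
  -- the crux applied to the admissible observable `2g`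
  have hg2c : Continuous fun w => 2 * g w := continuous_const.mul hg
  have hg2b : ∀ v, |2 * g v| ≤ κ := fun v => by
    rw [abs_mul, abs_two]
    linarith [hgκ v]
  have hg2o : ∀ (c₀ c₂ : ℝ) (b : V3),
      ∫ v, 2 * g v * (c₀ + inner ℝ b v + c₂ * ‖v‖ ^ 2) ∂(stdGaussian V3) = 0 := fun c₀ c₂ b => by
    simp_rw [mul_assoc]
    rw [integral_const_mul, horth c₀ c₂ b, mul_zero]
  obtain ⟨τ, hτ, N₀, hN⟩ := H' φ (fun w => 2 * g w) hφ hg2c hφ1 hg2b hg2o ε hε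
  refine ⟨τ, hτ, N₀, fun N hNN Φ => ?_⟩
  have hcr := hN N hNN Φ
  have e : ∫⁻ z, ENNReal.ofReal (Real.exp (2 * windowAvg Φ (fluxObs θ u₀ φ g N) (window τ N) z))
        ∂(gibbs σ a θ u₀ N Φ) =
      ∫⁻ z, ENNReal.ofReal (Real.exp (windowAvg Φ (fluxObs θ u₀ φ (fun w => 2 * g w) N) (window τ N) z))
        ∂(gibbs σ a θ u₀ N Φ) := by
    simp_rw [windowAvg_fluxObs_two_mul]
  refine (klDiv_tiltedGibbs_le_of_exp_two ha hθ hσ2 u₀ hφ hg hφ1 hgκ horth hτ N Φ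
    (e.trans_le hcr)).trans (ENNReal.ofReal_le_ofReal (le_of_eq ?_))
  push_cast
  ring

end Summit.AtomisticToContinuum.HydrodynamicLimit.Theorems.HTheorem

end
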